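import Mathlib.Analysis.Complex.Basic
import Mathlib.LinearAlgebra.Matrix.GeneralLinearGroup.Defs
import Mathlib.LinearAlgebra.Matrix.Determinant.Basic
import Mathlib.Logic.Equiv.Fin.Basic
import Literature.Computability.AlgebraicComplexity.MatrixMultiplicationExponent
import Literature.Computability.AlgebraicComplexity.AsymptoticSpectrum
import Literature.Computability.AlgebraicComplexity.SchoenhageTau
import HarnessLib

/-!
# Border rank of Kronecker powers of the little Coppersmith–Winograd tensors (CGLV 2022)

Topic: `Literature/Computability/AlgebraicComplexity`. Fact item `wi-04448` (MatrixMultiplication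
survey): the results of Conner–Gesmundo–Landsberg–Ventura, *Rank and border rank of Kronecker powers
of tensors and Strassen's laser method*, comput. complexity 31 (2022), arXiv:1909.04785v2, on the
border rank of `T_{cw,q}^{⊠2}`, `T_{cw,q}^{⊠3}`, `T_{cw,q}^{⊠N}`, the skew little Coppersmith–Winograd
tensors, and `det₃`, in the coordinate-tensor format `ι → κ → μ → K` of
`MatrixMultiplicationExponent.lean` (`triad`, `tensorRank`).

## Content (numbering of arXiv:1909.04785v2)

* Border rank is the tree's `algBorderRank` (`SchoenhageTau.lean`, Bläser 2013, Def. 6.1: order-`h`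
  approximate decompositions over `K[ε]`); over `ℂ` this coincides with CGLV's topological definition
  ("the smallest `r` such that `T` is the limit of rank-`r` tensors", §1.1) by Alder's theorem
  (Bläser 2013, §6; Bürgisser–Clausen–Shokrollahi 1997, §20.6), so the facts below are the printed ones.
  Kronecker powers are the tree's `kroneckerPow t N = t^{⊠N}` (`AsymptoticSpectrum.lean`).
* `cwTensor K q = T_{cw,q} = ∑_{j=1}^q a₀⊗b_j⊗c_j + a_j⊗b₀⊗c_j + a_j⊗b_j⊗c₀ ∈ (K^{q+1})^{⊗3}` (eq. (1)).
* `skewCwTensor K u = T_{skewcw,q}`, `q = 2u` (eq. (3)).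
* `leviCivita3`, `det3Tensor`, `perm3Tensor` — `det₃, perm₃ ∈ ℂ⁹ ⊗ ℂ⁹ ⊗ ℂ⁹` as printed before
  Lemma 2.4: `det₃ = (1/6) ∑_{σ,τ ∈ S₃} (-1)^{στ} a_{σ(1)τ(1)} ⊗ b_{σ(2)τ(2)} ⊗ c_{σ(3)τ(3)}`.
* `waringRank`, `borderWaringRank` — `R_S`, `bR_S` (§4).
* Named facts (`def … : Prop`): `CGLV2022_borderRank_cwTensor` (§1.2: `bR(T_{cw,q}) = q + 2`, `q ≥ 2`),
  `CGLV2022_thm12_square`, `_thm12_cube`, `_thm12_power`, `CGLV2022_thm12` (Thm. 1.2),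
  `CGLV2022_prop31` (Prop. 3.1 and `bR(T_{skewcw,2}) = 5`), `CGLV2022_lemma24` (Lemma 2.4),
  `CGLV2022_thm13` (Thm. 1.3), `CGLV2022_borderRank_skewCw2_sq_le` (§1.3: `bR(T_{skewcw,2}^{⊠2}) ≤ 17`).

## Design choices and wording risks

* Border *Waring* rank (`bR_S`, only needed for Thm. 1.3) has no algebraic counterpart in the tree and
  is formalised topologically as printed: the least `r` with `t` in the closure of the set of sums of
  `r` cubes `w ⊗ w ⊗ w`.
* No generic border-rank layer is (re)defined here (an earlier version duplicated it; the tree's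
  survivor is `SchoenhageTau.algBorderRank`); `cwTensor`/`skewCwTensor` have no other copy in the tree
  (`CoppersmithWinograd1990.lean` inlines the coordinates and is `rfl`-compatible).
* Thm. 1.2, third part, is printed "for all `N`" with exponents `N - 3`, `N - 2`; with truncated `ℕ`
  subtraction this would be false for small `N`, so the vendored statement assumes `N ≥ 3`
  (resp. `N ≥ 2`) — weaker than, never stronger than, the source.
* Lemma 2.4's "isomorphism of tensors" is: after the canonical reindexing
  `(Fin 2 → Fin 3) ≃ Fin 3 × Fin 3` of the Kronecker square, some `(A, B, C) ∈ GL₉(ℂ)³` maps one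
  tensor to the other (the action written as an explicit triple sum).
* `bR(T_{cw,q}) = q + 2` (§1.2, "one more than minimal", in the paper's standing range `q ≥ 2`) is
  vendored for `q ≥ 2` only: `T_{cw,0} = 0`, and `T_{cw,1} = e₀⊗e₁⊗e₁ + e₁⊗e₀⊗e₁ + e₁⊗e₁⊗e₀` is the
  `W` tensor, of border rank `2 = q + 1` (`(εe₀ + e₁)^{⊗3} − e₁^{⊗3} = ε T_{cw,1} + O(ε²)`), so the
  `q = 1` case would be false.
-/

noncomputable section

open scoped BigOperators Matrix

namespace Literature.Computability.AlgebraicComplexity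

universe u v₁ v₂ v₃

/-! ## Waring rank and border Waring rank -/

section Defs

variable {K : Type u} [CommSemiring K] {ι : Type v₁}

/-- The set of tensors admitting a Waring (symmetric) decomposition `∑_{i<r} w_i ⊗ w_i ⊗ w_i`.
[cite: ConnerGesmundoLandsbergVentura2022, §4 (p. 17)] -/
def waringLESet (ι : Type v₁) (K : Type u) [CommSemiring K] (r : ℕ) : Set (ι → ι → ι → K) :=
  {s | ∃ w : Fin r → ι → K, s = ∑ i, triad (w i) (w i) (w i)}

/-- **Waring rank** `R_S(t)`: the least `r` with `t = ∑_{i<r} w_i^{⊗3}` (CGLV §4); junk value `0` if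
`t` has no Waring decomposition (e.g. `t` not symmetric). [cite: ConnerGesmundoLandsbergVentura2022, §4 (p. 17)] -/
def waringRank (t : ι → ι → ι → K) : ℕ :=
  sInf {r : ℕ | t ∈ waringLESet ι K r}

/-- **Border Waring rank** `bR_S(t)`: the least `r` such that `t` is a limit of tensors of Waring
rank `≤ r` (CGLV §4), over a commutative topological semiring (`ℂ` in the facts).
[cite: ConnerGesmundoLandsbergVentura2022, §4 (p. 17)] -/
def borderWaringRank [TopologicalSpace K] (t : ι → ι → ι → K) : ℕ :=
  sInf {r : ℕ | t ∈ closure (waringLESet ι K r)}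

/-- A Waring decomposition with `r` cubes bounds `R_S` by `r`. [cite: ConnerGesmundoLandsbergVentura2022, §4 (p. 17)] -/
theorem waringRank_le_of_mem {t : ι → ι → ι → K} {r : ℕ} (h : t ∈ waringLESet ι K r) :
    waringRank t ≤ r :=
  Nat.sInf_le h

/-- `R(t) ≤ R_S(t)` whenever `t` has some Waring decomposition (a Waring decomposition is a triad
decomposition). [folklore] -/
theorem tensorRank_le_waringRank {t : ι → ι → ι → K} (h : ∃ r, t ∈ waringLESet ι K r) :
    tensorRank t ≤ waringRank t := by
  obtain ⟨w, e⟩ : t ∈ waringLESet ι K (waringRank t) :=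
    Nat.sInf_mem (s := {r | t ∈ waringLESet ι K r}) h
  exact tensorRank_le_of_eq_sum w w w e

/-- `bR(t) ≤ R_S(t)` (algebraic border rank, via `bR ≤ R ≤ R_S`) whenever `t` has some Waring
decomposition. [folklore] -/
theorem algBorderRank_le_waringRank {t : ι → ι → ι → K} (h : ∃ r, t ∈ waringLESet ι K r) :
    algBorderRank t ≤ waringRank t :=
  (algBorderRank_le_tensorRank t).trans (tensorRank_le_waringRank h)

/-- `bR_S(t) ≤ R_S(t)` whenever `t` has some Waring decomposition. [folklore] -/
theorem borderWaringRank_le_waringRank [TopologicalSpace K] {t : ι → ι → ι → K}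
    (h : ∃ r, t ∈ waringLESet ι K r) : borderWaringRank t ≤ waringRank t := by
  have hmem : t ∈ waringLESet ι K (waringRank t) := Nat.sInf_mem (s := {r | t ∈ waringLESet ι K r}) h
  exact Nat.sInf_le (subset_closure hmem)

end Defs

/-! ## The little Coppersmith–Winograd tensors and `det₃`, `perm₃` -/

section CW

variable (K : Type u) [CommSemiring K]

/-- **The little Coppersmith–Winograd tensor**
`T_{cw,q} = ∑_{j=1}^q a₀⊗b_j⊗c_j + a_j⊗b₀⊗c_j + a_j⊗b_j⊗c₀ ∈ (K^{q+1})^{⊗3}` (CGLV eq. (1)): entry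
`1` at `(0,j,j)`, `(j,0,j)`, `(j,j,0)` for `1 ≤ j ≤ q`, and `0` elsewhere.
[cite: ConnerGesmundoLandsbergVentura2022, eq. (1)] -/
def cwTensor (q : ℕ) : Fin (q + 1) → Fin (q + 1) → Fin (q + 1) → K :=
  fun i j k =>
    if (i = 0 ∧ j = k ∧ j ≠ 0) ∨ (j = 0 ∧ i = k ∧ i ≠ 0) ∨ (k = 0 ∧ i = j ∧ i ≠ 0) then 1 else 0

/-- Entries of `T_{cw,q}`. [cite: ConnerGesmundoLandsbergVentura2022, eq. (1)] -/
theorem cwTensor_apply (q : ℕ) (i j k : Fin (q + 1)) :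
    cwTensor K q i j k =
      if (i = 0 ∧ j = k ∧ j ≠ 0) ∨ (j = 0 ∧ i = k ∧ i ≠ 0) ∨ (k = 0 ∧ i = j ∧ i ≠ 0) then 1 else 0 :=
  rfl

/-- `T_{cw,q}` has entry `1` at `(0, j, j)`, `j ≠ 0`. [cite: ConnerGesmundoLandsbergVentura2022, eq. (1)] -/
theorem cwTensor_zero_left (q : ℕ) {j : Fin (q + 1)} (hj : j ≠ 0) : cwTensor K q 0 j j = 1 := by
  simp [cwTensor, hj]

/-- `T_{cw,q}` vanishes on the diagonal. [cite: ConnerGesmundoLandsbergVentura2022, eq. (1)] -/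
theorem cwTensor_diag (q : ℕ) (j : Fin (q + 1)) : cwTensor K q j j j = 0 := by
  by_cases hj : j = 0 <;> simp [cwTensor, hj]

/-- **The skew little Coppersmith–Winograd tensor** for even `q = 2u` (CGLV eq. (3)):
`T_{skewcw,q} = ∑_{j=1}^q (a₀⊗b_j⊗c_j + a_j⊗b₀⊗c_j) + ∑_{ξ=1}^{u} (a_ξ⊗b_{ξ+u} - a_{ξ+u}⊗b_ξ)⊗c₀`.
[cite: ConnerGesmundoLandsbergVentura2022, eq. (3)] -/
def skewCwTensor (R : Type u) [Ring R] (u : ℕ) : Fin (2 * u + 1) → Fin (2 * u + 1) → Fin (2 * u + 1) → R :=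
  fun i j k =>
    if (i = 0 ∧ j = k ∧ j ≠ 0) ∨ (j = 0 ∧ i = k ∧ i ≠ 0) then 1
    else if k = 0 ∧ 1 ≤ (i : ℕ) ∧ (i : ℕ) ≤ u ∧ (j : ℕ) = i + u then 1
    else if k = 0 ∧ 1 ≤ (j : ℕ) ∧ (j : ℕ) ≤ u ∧ (i : ℕ) = j + u then -1
    else 0

/-- The Levi-Civita symbol `ε_{ijk} = det(e_i, e_j, e_k)` on `{0,1,2}`: the sign of `(i,j,k)` as a
permutation of `(0,1,2)`, and `0` if two indices coincide. [folklore] -/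
def leviCivita3 (i j k : Fin 3) : ℤ :=
  Matrix.det (Matrix.of ![Pi.single i (1 : ℤ), Pi.single j 1, Pi.single k 1])

/-- **`det₃` as a tensor** in `ℂ⁹ ⊗ ℂ⁹ ⊗ ℂ⁹` (CGLV, display before Lemma 2.4):
`det₃ = (1/6) ∑_{σ,τ ∈ S₃} (-1)^{στ} a_{σ(1)τ(1)} ⊗ b_{σ(2)τ(2)} ⊗ c_{σ(3)τ(3)}`, i.e. entry
`(1/6) ε_{i₁i₂i₃} ε_{j₁j₂j₃}` at `((i₁,j₁),(i₂,j₂),(i₃,j₃))`.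
[cite: ConnerGesmundoLandsbergVentura2022, Lemma 2.4] -/
def det3Tensor : Fin 3 × Fin 3 → Fin 3 × Fin 3 → Fin 3 × Fin 3 → ℂ :=
  fun a b c => (1 / 6 : ℂ) * (leviCivita3 a.1 b.1 c.1 * leviCivita3 a.2 b.2 c.2 : ℤ)

/-- **`perm₃` as a tensor** in `ℂ⁹ ⊗ ℂ⁹ ⊗ ℂ⁹` (CGLV, display before Lemma 2.4):
`perm₃ = (1/6) ∑_{σ,τ ∈ S₃} a_{σ(1)τ(1)} ⊗ b_{σ(2)τ(2)} ⊗ c_{σ(3)τ(3)}`, i.e. entry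
`(1/6) |ε_{i₁i₂i₃}| |ε_{j₁j₂j₃}|`. [cite: ConnerGesmundoLandsbergVentura2022, Lemma 2.4] -/
def perm3Tensor : Fin 3 × Fin 3 → Fin 3 × Fin 3 → Fin 3 × Fin 3 → ℂ :=
  fun a b c => (1 / 6 : ℂ) * (|leviCivita3 a.1 b.1 c.1| * |leviCivita3 a.2 b.2 c.2| : ℤ)

/-- `ε₀₁₂ = 1`. [folklore] -/
theorem leviCivita3_012 : leviCivita3 0 1 2 = 1 := by
  simp [leviCivita3, Matrix.det_fin_three]

/-- `ε₁₀₂ = -1`. [folklore] -/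
theorem leviCivita3_102 : leviCivita3 1 0 2 = -1 := by
  simp [leviCivita3, Matrix.det_fin_three]

/-- `ε` vanishes when two indices coincide. [folklore] -/
theorem leviCivita3_self_left (i k : Fin 3) : leviCivita3 i i k = 0 := by
  fin_cases i <;> fin_cases k <;> simp [leviCivita3, Matrix.det_fin_three]

/-- The coefficient of `a_{11} ⊗ b_{22} ⊗ c_{33}` in `det₃` is `1/6`. [cite: ConnerGesmundoLandsbergVentura2022, Lemma 2.4] -/
theorem det3Tensor_diag : det3Tensor (0, 0) (1, 1) (2, 2) = 1 / 6 := by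
  simp [det3Tensor, leviCivita3_012]

end CW

/-! ## Named facts (CGLV 2022, over `ℂ`) -/

section Facts

/-- Reindex the Kronecker square `t^{⊠2}` (index types `Fin 2 → Fin 3`) to `Fin 3 × Fin 3` along
`finTwoArrowEquiv`. [folklore] -/
def squareReindex (t : (Fin 2 → Fin 3) → (Fin 2 → Fin 3) → (Fin 2 → Fin 3) → ℂ) :
    Fin 3 × Fin 3 → Fin 3 × Fin 3 → Fin 3 × Fin 3 → ℂ :=
  fun a b c => t ((finTwoArrowEquiv (Fin 3)).symm a) ((finTwoArrowEquiv (Fin 3)).symm b)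
    ((finTwoArrowEquiv (Fin 3)).symm c)

/-- Entries of the reindexed square. [folklore] -/
theorem squareReindex_kroneckerPow_two (t : Fin 3 → Fin 3 → Fin 3 → ℂ) (a b c : Fin 3 × Fin 3) :
    squareReindex (kroneckerPow t 2) a b c = t a.1 b.1 c.1 * t a.2 b.2 c.2 := by
  simp [squareReindex, finTwoArrowEquiv, Fin.prod_univ_two]

/-- **`bR(T_{cw,q}) = q + 2`** for `q ≥ 2` ("one more than minimal"; CGLV §1.2, p. 3, in the paper's
standing range `q ≥ 2`, citing [BCS97, §15.8]). Not asserted for `q = 1` (`T_{cw,1}` is the `W`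
tensor, `bR = 2`) nor `q = 0` (`T_{cw,0} = 0`). [cite: ConnerGesmundoLandsbergVentura2022, §1.2] -/
def CGLV2022_borderRank_cwTensor : Prop :=
  ∀ q : ℕ, 2 ≤ q → algBorderRank (cwTensor ℂ q) = q + 2

/-- **CGLV Thm. 1.2, Kronecker squares**: for all `q > 2`, `bR(T_{cw,q}^{⊠2}) = (q+2)²`; moreover
`15 ≤ bR(T_{cw,2}^{⊠2}) ≤ 16`. [cite: ConnerGesmundoLandsbergVentura2022, Thm. 1.2] -/
def CGLV2022_thm12_square : Prop :=
  (∀ q : ℕ, 2 < q → algBorderRank (kroneckerPow (cwTensor ℂ q) 2) = (q + 2) ^ 2) ∧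
    15 ≤ algBorderRank (kroneckerPow (cwTensor ℂ 2) 2) ∧
    algBorderRank (kroneckerPow (cwTensor ℂ 2) 2) ≤ 16

/-- **CGLV Thm. 1.2, Kronecker cubes**: for all `q > 4`, `bR(T_{cw,q}^{⊠3}) = (q+2)³`; if `q = 3, 4`
then `bR(T_{cw,q}^{⊠3}) ≥ (q+2)²(q+1)`; if `q = 2` then `bR(T_{cw,2}^{⊠3}) ≥ 15·3`.
[cite: ConnerGesmundoLandsbergVentura2022, Thm. 1.2] -/
def CGLV2022_thm12_cube : Prop :=
  (∀ q : ℕ, 4 < q → algBorderRank (kroneckerPow (cwTensor ℂ q) 3) = (q + 2) ^ 3) ∧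
    (∀ q : ℕ, q = 3 ∨ q = 4 → (q + 2) ^ 2 * (q + 1) ≤ algBorderRank (kroneckerPow (cwTensor ℂ q) 3)) ∧
    15 * 3 ≤ algBorderRank (kroneckerPow (cwTensor ℂ 2) 3)

/-- **CGLV Thm. 1.2, higher Kronecker powers**: for all `q > 4` and all `N` (here `N ≥ 3`),
`bR(T_{cw,q}^{⊠N}) ≥ (q+1)^{N-3}(q+2)³`; if `q = 3, 4` then (here `N ≥ 2`)
`bR(T_{cw,q}^{⊠N}) ≥ (q+2)²(q+1)^{N-2}`; if `q = 2` then (here `N ≥ 2`) `bR(T_{cw,2}^{⊠N}) ≥ 15·3^{N-2}`.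
The side conditions on `N` make the truncated exponents genuine (see module docstring).
[cite: ConnerGesmundoLandsbergVentura2022, Thm. 1.2] -/
def CGLV2022_thm12_power : Prop :=
  (∀ q N : ℕ, 4 < q → 3 ≤ N →
      (q + 1) ^ (N - 3) * (q + 2) ^ 3 ≤ algBorderRank (kroneckerPow (cwTensor ℂ q) N)) ∧
    (∀ q N : ℕ, q = 3 ∨ q = 4 → 2 ≤ N →
      (q + 2) ^ 2 * (q + 1) ^ (N - 2) ≤ algBorderRank (kroneckerPow (cwTensor ℂ q) N)) ∧
    (∀ N : ℕ, 2 ≤ N → 15 * 3 ^ (N - 2) ≤ algBorderRank (kroneckerPow (cwTensor ℂ 2) N))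

/-- **CGLV Thm. 1.2** (answering Bläser 2013, Problem 9.8): the conjunction of the three parts.
[cite: ConnerGesmundoLandsbergVentura2022, Thm. 1.2] -/
def CGLV2022_thm12 : Prop :=
  CGLV2022_thm12_square ∧ CGLV2022_thm12_cube ∧ CGLV2022_thm12_power

/-- Projections of Thm. 1.2. [cite: ConnerGesmundoLandsbergVentura2022, Thm. 1.2] -/
theorem CGLV2022_thm12.square (h : CGLV2022_thm12) : CGLV2022_thm12_square := h.1

/-- Projections of Thm. 1.2. [cite: ConnerGesmundoLandsbergVentura2022, Thm. 1.2] -/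
theorem CGLV2022_thm12.cube (h : CGLV2022_thm12) : CGLV2022_thm12_cube := h.2.1

/-- Projections of Thm. 1.2. [cite: ConnerGesmundoLandsbergVentura2022, Thm. 1.2] -/
theorem CGLV2022_thm12.power (h : CGLV2022_thm12) : CGLV2022_thm12_power := h.2.2

/-- From Thm. 1.2: the Kronecker square of `T_{cw,q}`, `q > 2`, has multiplicative border rank
`(q+2)² = bR(T_{cw,q})²` (using `bR(T_{cw,q}) = q+2`), so squares give no laser-method improvement.
[cite: ConnerGesmundoLandsbergVentura2022, Thm. 1.2] -/
theorem CGLV2022_thm12_square.eq_sq (h : CGLV2022_thm12_square) (h₀ : CGLV2022_borderRank_cwTensor)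
    {q : ℕ} (hq : 2 < q) :
    algBorderRank (kroneckerPow (cwTensor ℂ q) 2) = algBorderRank (cwTensor ℂ q) ^ 2 := by
  rw [h.1 q hq, h₀ q (by omega)]

/-- **CGLV Prop. 3.1**: for every even `q = 2u ≥ 2`, `bR(T_{skewcw,q}) ≥ q + 3`; in particular
(§1.3) `bR(T_{skewcw,2}) = 5`. [cite: ConnerGesmundoLandsbergVentura2022, Prop. 3.1] -/
def CGLV2022_prop31 : Prop :=
  (∀ u : ℕ, 1 ≤ u → 2 * u + 3 ≤ algBorderRank (skewCwTensor ℂ u)) ∧ algBorderRank (skewCwTensor ℂ 1) = 5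

/-- **CGLV Lemma 2.4**: `T_{cw,2}^{⊠2} ≅ perm₃` and `T_{skewcw,2}^{⊠2} ≅ det₃` as tensors in
`ℂ⁹ ⊗ ℂ⁹ ⊗ ℂ⁹`, i.e. some `(A, B, C) ∈ GL₉(ℂ)³` carries the (reindexed) Kronecker square to
`perm₃`, resp. `det₃`. [cite: ConnerGesmundoLandsbergVentura2022, Lemma 2.4] -/
def CGLV2022_lemma24 : Prop :=
  (∃ g : GL (Fin 3 × Fin 3) ℂ × GL (Fin 3 × Fin 3) ℂ × GL (Fin 3 × Fin 3) ℂ,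
    (fun a b c => ∑ a', ∑ b', ∑ c', (g.1 : Matrix _ _ ℂ) a a' * (g.2.1 : Matrix _ _ ℂ) b b' *
        (g.2.2 : Matrix _ _ ℂ) c c' * squareReindex (kroneckerPow (cwTensor ℂ 2) 2) a' b' c') =
      perm3Tensor) ∧
  (∃ g : GL (Fin 3 × Fin 3) ℂ × GL (Fin 3 × Fin 3) ℂ × GL (Fin 3 × Fin 3) ℂ,
    (fun a b c => ∑ a', ∑ b', ∑ c', (g.1 : Matrix _ _ ℂ) a a' * (g.2.1 : Matrix _ _ ℂ) b b' *
        (g.2.2 : Matrix _ _ ℂ) c c' * squareReindex (kroneckerPow (skewCwTensor ℂ 1) 2) a' b' c') =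
      det3Tensor)

/-- **CGLV Thm. 1.3**: `R_S(det₃) ≤ 18` and `bR_S(det₃) ≤ 17` (Waring rank and border Waring rank
of the `3 × 3` determinant regarded as a symmetric tensor; the second is an equality by [CHL19],
not vendored). [cite: ConnerGesmundoLandsbergVentura2022, Thm. 1.3] -/
def CGLV2022_thm13 : Prop :=
  waringRank det3Tensor ≤ 18 ∧ borderWaringRank det3Tensor ≤ 17

/-- **CGLV §1.3**: strict submultiplicativity for the skew tensor,
`bR(T_{skewcw,2}^{⊠2}) ≤ 17 < 25 = bR(T_{skewcw,2})²` (from Lemma 2.4 and Thm. 1.3).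
[cite: ConnerGesmundoLandsbergVentura2022, §1.3 (p. 4)] -/
def CGLV2022_borderRank_skewCw2_sq_le : Prop :=
  algBorderRank (kroneckerPow (skewCwTensor ℂ 1) 2) ≤ 17

/-- With Prop. 3.1 this is strict submultiplicativity: `bR(T^{⊠2}) < bR(T)²` for `T = T_{skewcw,2}`.
[cite: ConnerGesmundoLandsbergVentura2022, §1.3 (p. 4)] -/
theorem CGLV2022_borderRank_skewCw2_sq_le.lt_sq (h : CGLV2022_borderRank_skewCw2_sq_le)
    (h' : CGLV2022_prop31) :
    algBorderRank (kroneckerPow (skewCwTensor ℂ 1) 2) < algBorderRank (skewCwTensor ℂ 1) ^ 2 := by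
  have h5 : algBorderRank (skewCwTensor ℂ 1) = 5 := h'.2
  have h17 : algBorderRank (kroneckerPow (skewCwTensor ℂ 1) 2) ≤ 17 := h
  rw [h5]
  omega

end Facts

end Literature.Computability.AlgebraicComplexity

end
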